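import Literature.Probability.RandomMatrixProducts.AndersonModel1DPositivity
import Literature.Probability.RandomMatrixProducts.AndersonModel1DContinuityStationary
import Mathlib.MeasureTheory.Measure.Support
import HarnessLib

/-!
# Fürstenberg positivity for the one-dimensional Anderson model with an arbitrary single-site law: proof of `BucajEtAl2019_lyapunovPos`

This file discharges the named fact `BucajEtAl2019_lyapunovPos` of `AndersonModel1D.lean`
(Bucaj–Damanik–Fillman–Gerbuz–VandenBoom–Wang–Zhang, TAMS **372** (2019) 3619–3667, Thm 2.3:
`L(E) > 0` for every `E` as soon as the single-site law has compact support containing two points).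
In the source Thm 2.3 is ten lines on top of Fürstenberg's theorem (Thm 2.1 there, cited from
Furstenberg 1963 / Bougerol–Lacroix); here Fürstenberg's theorem is PROVED for these laws.

`AndersonModel1DPositivity.lean` proves the absolutely continuous case by Fürstenberg's entropy
argument made quantitative in the slope chart (`entropy_step`: entropy production ≥ Hellinger
variance of the pushed densities; `andersonLogNormAvg_ge`: summation along the slope chain), the
density bound on the site law entering only through the non-invariance input
`hellinger_variance_lower` (uniform tails of the iterated densities).  This file replaces that input
by a **two-step non-invariance bound valid for every law whose support has two points `a₀ ≠ b₀`**
(`exists_hellinger_two_step_lower`), which needs no tail estimate: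

* per-set control by the Hellinger variance `V(φ) = ∫∫ (√(P_{E-α}φ) - √(Pφ))² dm dμ`:
  `∫ |m_{P_{E-α}φ}(S) - m_{Pφ}(S)| dμ(α) ≤ V(φ)/c + c` (`integral_abs_mass_sub_le`);
* averaging over the balls `B(a₀,r)`, `B(b₀,r)` (positive `μ`-mass since `a₀, b₀ ∈ supp μ`) and the
  shear identity (`A(a')⁻¹A(a)` is the translation `s ↦ s + (a - a')` of the slope line): if both
  `V(φ)` and `V(Pφ)` are small then the law `(Pφ) m` is almost invariant under translation by
  `t = b₀ - a₀ ≠ 0` up to `r`-fattening of intervals, hence (four disjoint translates) gives mass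
  `≤ 1/4 + O(δ)` to `[-R, R]`; pulling the complement `{|y| > R}` back through ONE step puts
  `φ m`-mass `≥ 3/4 - O(δ)` in each of the two disjoint windows `E - a₀ ± (r + 1/R)`,
  `E - b₀ ± (r + 1/R)` — a contradiction.  So `V(φ) + V(Pφ) ≥ r₀(μ) > 0` for EVERY density `φ`;
* summation (`andersonLogNormAvg_ge_of_nontrivial`, pairing consecutive steps):
  `n⁻¹ 𝔼 log ‖M_n^E‖ ≥ r₀/6` for `n ≥ 2`, and `𝔼 log ‖M_1^E‖ > 0` directly; hence `L(E) > 0`.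

This is the classical mechanism of Fürstenberg's theorem (no `μ`-a.e.-invariant measure on `ℝP¹` for
the two-step law; Gorodetski–Kleptsyn's "measures condition") in finite, quantitative form.

References: H. Furstenberg, *Noncommuting random products*, Trans. AMS 108 (1963), Thm 8.6;
Bucaj et al., TAMS 372 (2019), Thm 2.1 & Thm 2.3; A. Gorodetski, V. Kleptsyn, *Non-stationary
version of Furstenberg Theorem on random matrix products*, arXiv:2210.03805, §2 (entropy argument,
Thm 1.5/1.6, Remark 1.9 on two-step laws).

## Continuity of the Lyapunov exponent (`BucajEtAl2019_lyapunovContinuous_holds`, appended)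

Section `Continuity` at the end discharges `BucajEtAl2019_lyapunovContinuous` (Thm 2.6 of Bucaj et al.:
`E ↦ L(E)` is continuous).  The printed proof invokes the Fürstenberg–Kifer theorem (Thm 2.5 there,
[FK83]) and the strong irreducibility of `G_{ν_E}` (Thm 2.3 there); the formal proof assembles the
elementary route of `AndersonModel1DContinuityBasics.lean` (finite-volume estimates, upper
semicontinuity, `inf_v 𝔼 log ‖M_n v‖ ≤ nL`) and `AndersonModel1DContinuityStationary.lean`
(stationary measures on the circle have no atoms and all attain `L`; uniform vector growth at one
scale).  Reference: H. Furstenberg, Y. Kifer, *Random matrix products and measures on projective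
spaces*, Israel J. Math. **46** (1983) 12–32.
-/

noncomputable section

open MeasureTheory ProbabilityTheory Set Filter
open scoped ENNReal NNReal Matrix.Norms.L2Operator

namespace Literature.Probability.RandomMatrixProducts

section Mass

variable {ψ : ℝ → ℝ}

/-- Masses `∫ 1_S ψ dm` are set integrals. [folklore] -/
theorem integral_indicator_one_mul_eq_setIntegral (ψ : ℝ → ℝ) {S : Set ℝ} (hS : MeasurableSet S) :
    ∫ s, S.indicator (fun _ => (1 : ℝ)) s * ψ s ∂(cauchyMeasure 0 1) =
      ∫ s in S, ψ s ∂(cauchyMeasure 0 1) := by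
  simp_rw [indicator_one_mul]
  exact integral_indicator hS

/-- Masses of a nonnegative density are monotone in the set. [folklore] -/
theorem integral_indicator_one_mul_mono (hψ0 : ∀ s, 0 ≤ ψ s) (hψi : Integrable ψ (cauchyMeasure 0 1))
    {S S' : Set ℝ} (hS : MeasurableSet S) (hS' : MeasurableSet S') (h : S ⊆ S') :
    ∫ s, S.indicator (fun _ => (1 : ℝ)) s * ψ s ∂(cauchyMeasure 0 1) ≤
      ∫ s, S'.indicator (fun _ => (1 : ℝ)) s * ψ s ∂(cauchyMeasure 0 1) := by
  rw [integral_indicator_one_mul_eq_setIntegral ψ hS, integral_indicator_one_mul_eq_setIntegral ψ hS']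
  exact setIntegral_mono_set hψi.integrableOn (Eventually.of_forall fun s => hψ0 s)
    (Eventually.of_forall h)

/-- Masses of a nonnegative density are nonnegative. [folklore] -/
theorem integral_indicator_one_mul_nonneg (hψ0 : ∀ s, 0 ≤ ψ s) (S : Set ℝ) :
    0 ≤ ∫ s, S.indicator (fun _ => (1 : ℝ)) s * ψ s ∂(cauchyMeasure 0 1) :=
  integral_nonneg fun s => by
    rw [indicator_one_mul]; exact Set.indicator_nonneg (fun _ _ => hψ0 _) _

/-- Mass of a set plus mass of its complement is the total mass. [folklore] -/
theorem integral_indicator_one_mul_add_compl (hψi : Integrable ψ (cauchyMeasure 0 1)) {S : Set ℝ}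
    (hS : MeasurableSet S) :
    (∫ s, S.indicator (fun _ => (1 : ℝ)) s * ψ s ∂(cauchyMeasure 0 1)) +
        ∫ s, Sᶜ.indicator (fun _ => (1 : ℝ)) s * ψ s ∂(cauchyMeasure 0 1) =
      ∫ s, ψ s ∂(cauchyMeasure 0 1) := by
  rw [integral_indicator_one_mul_eq_setIntegral ψ hS, integral_indicator_one_mul_eq_setIntegral ψ hS.compl]
  exact integral_add_compl hS hψi

/-- Masses of finitely many pairwise disjoint sets add up to at most the total mass. [folklore] -/
theorem sum_integral_indicator_one_mul_le (hψ0 : ∀ s, 0 ≤ ψ s) (hψi : Integrable ψ (cauchyMeasure 0 1))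
    {ι : Type*} (t : Finset ι) {S : ι → Set ℝ} (hS : ∀ i ∈ t, MeasurableSet (S i))
    (hdisj : Set.Pairwise (↑t) (Function.onFun Disjoint S)) :
    ∑ i ∈ t, ∫ s, (S i).indicator (fun _ => (1 : ℝ)) s * ψ s ∂(cauchyMeasure 0 1) ≤
      ∫ s, ψ s ∂(cauchyMeasure 0 1) := by
  have h1 : ∑ i ∈ t, ∫ s, (S i).indicator (fun _ => (1 : ℝ)) s * ψ s ∂(cauchyMeasure 0 1) =
      ∑ i ∈ t, ∫ s in S i, ψ s ∂(cauchyMeasure 0 1) :=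
    Finset.sum_congr rfl fun i hi => integral_indicator_one_mul_eq_setIntegral ψ (hS i hi)
  rw [h1, ← integral_biUnion_finset t hS hdisj fun i _ => hψi.integrableOn]
  exact setIntegral_le_integral hψi (Eventually.of_forall fun s => hψ0 s)

/-- **Push-forward of masses**: the `(P_a φ) m`-mass of `S` is the `φ m`-mass of `mobStep a ⁻¹' S`.
[folklore] -/
theorem integral_indicator_one_mul_pushDensity (a : ℝ) (φ : ℝ → ℝ) (S : Set ℝ) :
    ∫ y, S.indicator (fun _ => (1 : ℝ)) y * pushDensity a φ y ∂(cauchyMeasure 0 1) =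
      ∫ s, (mobStep a ⁻¹' S).indicator (fun _ => (1 : ℝ)) s * φ s ∂(cauchyMeasure 0 1) := by
  rw [← integral_mobStep_cauchy a (S.indicator fun _ => (1 : ℝ)) φ]
  rfl

end Mass

section PerSet

variable {μ : Measure ℝ} {E D B : ℝ} {φ : ℝ → ℝ}

/-- Measurability in the site of the pushed mass `α ↦ ∫ 1_S P_{E-α}φ dm`. [folklore] -/
theorem measurable_mass_pushDensity (hφ : Measurable φ) {S : Set ℝ} (hS : MeasurableSet S) :
    Measurable fun α => ∫ y, S.indicator (fun _ => (1 : ℝ)) y * pushDensity (E - α) φ y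
      ∂(cauchyMeasure 0 1) := by
  have hm : Measurable fun p : ℝ × ℝ => S.indicator (fun _ => (1 : ℝ)) p.2 * pushDensity (E - p.1) φ p.2 :=
    ((measurable_const.indicator hS).comp measurable_snd).mul (measurable_pushDensity_sub hφ E)
  exact (hm.stronglyMeasurable.integral_prod_right' (ν := cauchyMeasure 0 1)).measurable

/-- **Per-set control by the Hellinger variance**: for a probability density `0 < φ ≤ B`, a
measurable `S` and `c > 0`,
`∫ |m_{P_{E-α}φ}(S) - m_{Pφ}(S)| dμ(α) ≤ V(φ)/c + c`, `V(φ) = ∫∫ (√(P_{E-α}φ) - √(Pφ))² dm dμ`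
(per site `|Δ| ≤ 2√h_α ≤ h_α/c + c`). [folklore] -/
theorem integral_abs_mass_sub_le [IsProbabilityMeasure μ] (hD : ∀ᵐ α ∂μ, (E - α) ^ 2 + 2 ≤ D)
    (hφ : Measurable φ) (hφ0 : ∀ s, 0 < φ s) (hφB : ∀ s, φ s ≤ B) (hB : 1 ≤ B)
    (hφ1 : ∫ s, φ s ∂(cauchyMeasure 0 1) = 1) {S : Set ℝ} (hS : MeasurableSet S) {c : ℝ} (hc : 0 < c) :
    ∫ α, |(∫ y, S.indicator (fun _ => (1 : ℝ)) y * pushDensity (E - α) φ y ∂(cauchyMeasure 0 1)) -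
        ∫ y, S.indicator (fun _ => (1 : ℝ)) y * transferOp μ E φ y ∂(cauchyMeasure 0 1)| ∂μ ≤
      (∫ α, ∫ y, (Real.sqrt (pushDensity (E - α) φ y) - Real.sqrt (transferOp μ E φ y)) ^ 2
        ∂(cauchyMeasure 0 1) ∂μ) / c + c := by
  have hφ0' : ∀ s, 0 ≤ φ s := fun s => (hφ0 s).le
  have hT := measurable_transferOp (μ := μ) (E := E) hφ
  set g : ℝ → ℝ := fun α => ∫ y, (Real.sqrt (pushDensity (E - α) φ y) -
    Real.sqrt (transferOp μ E φ y)) ^ 2 ∂(cauchyMeasure 0 1) with hg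
  have hgi : Integrable g μ := (integrable_prod_hellinger hD hφ hφ0 hφB hB).integral_prod_left
  have hg0 : ∀ α, 0 ≤ g α := fun α => integral_nonneg fun y => sq_nonneg _
  -- integrability in y of the Hellinger integrands, for every α
  have hIy : ∀ α, Integrable (fun y => (Real.sqrt (pushDensity (E - α) φ y) -
      Real.sqrt (transferOp μ E φ y)) ^ 2) (cauchyMeasure 0 1) := by
    intro α
    refine integrable_cauchy_of_bound (((measurable_pushDensity _ hφ).sqrt.sub hT.sqrt).pow_const 2)
      (B * ((E - α) ^ 2 + 2) + B * D) fun y => ?_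
    have h1 := pushDensity_le (E - α) hφ0' hφB y
    have h2 : transferOp μ E φ y ≤ B * D := transferOp_le hD hφ0' hφB _
    have h3 := pushDensity_nonneg (E - α) hφ0' y
    have h4 := transferOp_nonneg (μ := μ) (E := E) hφ0' y
    rw [abs_of_nonneg (sq_nonneg _), sub_sq, Real.sq_sqrt h3, Real.sq_sqrt h4]
    nlinarith [mul_nonneg (Real.sqrt_nonneg (pushDensity (E - α) φ y))
      (Real.sqrt_nonneg (transferOp μ E φ y))]
  have hBa : ∀ a : ℝ, Integrable (pushDensity a φ) (cauchyMeasure 0 1) := fun a =>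
    integrable_cauchy_of_bound (measurable_pushDensity a hφ) (B * (a ^ 2 + 2)) fun y => by
      rw [abs_of_nonneg (pushDensity_nonneg a hφ0' y)]; exact pushDensity_le a hφ0' hφB y
  have hTi : Integrable (transferOp μ E φ) (cauchyMeasure 0 1) :=
    integrable_cauchy_of_bound hT (B * D) fun y => by
      rw [abs_of_nonneg (transferOp_nonneg hφ0' y)]; exact transferOp_le hD hφ0' hφB y
  have hmassP : ∀ a : ℝ, ∫ y, pushDensity a φ y ∂(cauchyMeasure 0 1) = 1 := fun a => by
    rw [integral_pushDensity, hφ1]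
  have hmassT : ∫ y, transferOp μ E φ y ∂(cauchyMeasure 0 1) = 1 := by
    rw [integral_transferOp hD hφ hφ0' hφB, hφ1]
  have hind : Measurable (S.indicator fun _ => (1 : ℝ)) := measurable_const.indicator hS
  have hind1 : ∀ y, |S.indicator (fun _ => (1 : ℝ)) y| ≤ 1 := fun y => by
    by_cases hy : y ∈ S <;> simp [hy]
  -- pointwise bound
  have hpt : ∀ α, |(∫ y, S.indicator (fun _ => (1 : ℝ)) y * pushDensity (E - α) φ y ∂(cauchyMeasure 0 1)) -
      ∫ y, S.indicator (fun _ => (1 : ℝ)) y * transferOp μ E φ y ∂(cauchyMeasure 0 1)| ≤ g α / c + c := by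
    intro α
    have h1 := abs_integral_sub_le_two_hellinger (ν := cauchyMeasure 0 1) hind
      (pushDensity_nonneg (E - α) hφ0') (transferOp_nonneg hφ0') hind1 (hBa (E - α)) hTi (hmassP _)
      hmassT (hIy α)
    refine h1.trans ?_
    -- 2 √g ≤ g/c + c
    have hs := Real.sqrt_nonneg (g α)
    have hsq : Real.sqrt (g α) ^ 2 = g α := Real.sq_sqrt (hg0 α)
    have key : 0 ≤ (Real.sqrt (g α) - c) ^ 2 := sq_nonneg _
    rw [div_add' _ _ _ hc.ne', le_div_iff₀ hc]
    nlinarith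
  have hmeasΔ : Measurable fun α => |(∫ y, S.indicator (fun _ => (1 : ℝ)) y * pushDensity (E - α) φ y
      ∂(cauchyMeasure 0 1)) - ∫ y, S.indicator (fun _ => (1 : ℝ)) y * transferOp μ E φ y ∂(cauchyMeasure 0 1)| :=
    continuous_abs.measurable.comp ((measurable_mass_pushDensity (E := E) hφ hS).sub measurable_const)
  have hIΔ : Integrable (fun α => |(∫ y, S.indicator (fun _ => (1 : ℝ)) y * pushDensity (E - α) φ y
      ∂(cauchyMeasure 0 1)) - ∫ y, S.indicator (fun _ => (1 : ℝ)) y * transferOp μ E φ y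
        ∂(cauchyMeasure 0 1)|) μ := by
    refine Integrable.mono' ((hgi.div_const c).add (integrable_const c)) hmeasΔ.aestronglyMeasurable ?_
    exact Eventually.of_forall fun α => by
      rw [Real.norm_eq_abs, abs_abs]; exact hpt α
  calc ∫ α, |(∫ y, S.indicator (fun _ => (1 : ℝ)) y * pushDensity (E - α) φ y ∂(cauchyMeasure 0 1)) -
        ∫ y, S.indicator (fun _ => (1 : ℝ)) y * transferOp μ E φ y ∂(cauchyMeasure 0 1)| ∂μ
      ≤ ∫ α, (g α / c + c) ∂μ := integral_mono hIΔ ((hgi.div_const c).add (integrable_const c)) hpt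
    _ = (∫ α, g α ∂μ) / c + c := by
        rw [integral_add (hgi.div_const c) (integrable_const c), integral_div, integral_const,
          probReal_univ, one_smul]

/-- **Averaging over a set of sites, upper form**: if `mobStep (E-α) ⁻¹' S ⊆ S'` for all `α` in a set
`Bl` of positive `μ`-mass, then `m_{Pφ}(S) ≤ m_φ(S') + (∫ |Δ_S| dμ)/μ(Bl)`. [folklore] -/
theorem mass_transferOp_le_of_forall_mem [IsProbabilityMeasure μ] (hφ0 : ∀ s, 0 ≤ φ s)
    (hφi : Integrable φ (cauchyMeasure 0 1)) {S S' : Set ℝ} (hS : MeasurableSet S) (hS' : MeasurableSet S')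
    {Bl : Set ℝ} (hBl : MeasurableSet Bl) (hp : 0 < μ.real Bl)
    (hsub : ∀ α ∈ Bl, mobStep (E - α) ⁻¹' S ⊆ S')
    (hIΔ : Integrable (fun α => |(∫ y, S.indicator (fun _ => (1 : ℝ)) y * pushDensity (E - α) φ y
      ∂(cauchyMeasure 0 1)) - ∫ y, S.indicator (fun _ => (1 : ℝ)) y * transferOp μ E φ y
        ∂(cauchyMeasure 0 1)|) μ) :
    ∫ y, S.indicator (fun _ => (1 : ℝ)) y * transferOp μ E φ y ∂(cauchyMeasure 0 1) ≤
      (∫ s, S'.indicator (fun _ => (1 : ℝ)) s * φ s ∂(cauchyMeasure 0 1)) +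
        (∫ α, |(∫ y, S.indicator (fun _ => (1 : ℝ)) y * pushDensity (E - α) φ y ∂(cauchyMeasure 0 1)) -
          ∫ y, S.indicator (fun _ => (1 : ℝ)) y * transferOp μ E φ y ∂(cauchyMeasure 0 1)| ∂μ) /
          μ.real Bl := by
  set cT := ∫ y, S.indicator (fun _ => (1 : ℝ)) y * transferOp μ E φ y ∂(cauchyMeasure 0 1) with hcT
  set X := ∫ s, S'.indicator (fun _ => (1 : ℝ)) s * φ s ∂(cauchyMeasure 0 1) with hX
  set f : ℝ → ℝ := fun α => ∫ y, S.indicator (fun _ => (1 : ℝ)) y * pushDensity (E - α) φ y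
    ∂(cauchyMeasure 0 1) with hf
  -- pointwise on the ball: cT ≤ X + |f α - cT|
  have hpt : ∀ α ∈ Bl, cT ≤ X + |f α - cT| := by
    intro α hα
    have h1 : f α ≤ X := by
      rw [hf]; dsimp only
      rw [integral_indicator_one_mul_pushDensity]
      exact integral_indicator_one_mul_mono hφ0 hφi ((measurable_mobStep_uncurry.comp
        (measurable_const.prodMk measurable_id)) hS) hS' (hsub α hα)
    have h2 : cT ≤ f α + |f α - cT| := by
      have := neg_abs_le (f α - cT); linarith
    linarith
  have hconst : IntegrableOn (fun _ : ℝ => cT) Bl μ := integrableOn_const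
  have hrhs' : IntegrableOn (fun α => X + |f α - cT|) Bl μ :=
    ((integrable_const X).add hIΔ).integrableOn
  have hint : ∫ α in Bl, cT ∂μ ≤ ∫ α in Bl, (X + |f α - cT|) ∂μ :=
    setIntegral_mono_on hconst hrhs' hBl hpt
  rw [setIntegral_const, smul_eq_mul] at hint
  have hsplit : ∫ α in Bl, (X + |f α - cT|) ∂μ = μ.real Bl * X + ∫ α in Bl, |f α - cT| ∂μ := by
    rw [integral_add (integrable_const X).integrableOn hIΔ.integrableOn, setIntegral_const, smul_eq_mul]
  have hle : ∫ α in Bl, |f α - cT| ∂μ ≤ ∫ α, |f α - cT| ∂μ :=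
    setIntegral_le_integral hIΔ (Eventually.of_forall fun α => abs_nonneg _)
  rw [hsplit] at hint
  have key : μ.real Bl * cT ≤ μ.real Bl * X + ∫ α, |f α - cT| ∂μ := hint.trans (by linarith)
  have : cT ≤ X + (∫ α, |f α - cT| ∂μ) / μ.real Bl := by
    rw [add_div' _ _ _ hp.ne', le_div_iff₀ hp]
    nlinarith
  exact this

/-- **Averaging over a set of sites, lower form**: if `S'' ⊆ mobStep (E-α) ⁻¹' S` for all `α` in a set
`Bl` of positive `μ`-mass, then `m_φ(S'') ≤ m_{Pφ}(S) + (∫ |Δ_S| dμ)/μ(Bl)`. [folklore] -/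
theorem mass_le_mass_transferOp_of_forall_mem [IsProbabilityMeasure μ]
    (hφ0 : ∀ s, 0 ≤ φ s) (hφi : Integrable φ (cauchyMeasure 0 1)) {S S'' : Set ℝ}
    (hS : MeasurableSet S) (hS'' : MeasurableSet S'') {Bl : Set ℝ} (hBl : MeasurableSet Bl)
    (hp : 0 < μ.real Bl) (hsub : ∀ α ∈ Bl, S'' ⊆ mobStep (E - α) ⁻¹' S)
    (hIΔ : Integrable (fun α => |(∫ y, S.indicator (fun _ => (1 : ℝ)) y * pushDensity (E - α) φ y
      ∂(cauchyMeasure 0 1)) - ∫ y, S.indicator (fun _ => (1 : ℝ)) y * transferOp μ E φ y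
        ∂(cauchyMeasure 0 1)|) μ) :
    ∫ s, S''.indicator (fun _ => (1 : ℝ)) s * φ s ∂(cauchyMeasure 0 1) ≤
      (∫ y, S.indicator (fun _ => (1 : ℝ)) y * transferOp μ E φ y ∂(cauchyMeasure 0 1)) +
        (∫ α, |(∫ y, S.indicator (fun _ => (1 : ℝ)) y * pushDensity (E - α) φ y ∂(cauchyMeasure 0 1)) -
          ∫ y, S.indicator (fun _ => (1 : ℝ)) y * transferOp μ E φ y ∂(cauchyMeasure 0 1)| ∂μ) /
          μ.real Bl := by
  set cT := ∫ y, S.indicator (fun _ => (1 : ℝ)) y * transferOp μ E φ y ∂(cauchyMeasure 0 1) with hcT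
  set X := ∫ s, S''.indicator (fun _ => (1 : ℝ)) s * φ s ∂(cauchyMeasure 0 1) with hX
  set f : ℝ → ℝ := fun α => ∫ y, S.indicator (fun _ => (1 : ℝ)) y * pushDensity (E - α) φ y
    ∂(cauchyMeasure 0 1) with hf
  have hpt : ∀ α ∈ Bl, X ≤ cT + |f α - cT| := by
    intro α hα
    have h1 : X ≤ f α := by
      rw [hf]; dsimp only
      rw [integral_indicator_one_mul_pushDensity]
      exact integral_indicator_one_mul_mono hφ0 hφi hS'' ((measurable_mobStep_uncurry.comp
        (measurable_const.prodMk measurable_id)) hS) (hsub α hα)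
    have h2 : f α ≤ cT + |f α - cT| := by
      have := le_abs_self (f α - cT); linarith
    linarith
  have hconst : IntegrableOn (fun _ : ℝ => X) Bl μ := integrableOn_const
  have hrhs' : IntegrableOn (fun α => cT + |f α - cT|) Bl μ :=
    ((integrable_const cT).add hIΔ).integrableOn
  have hint : ∫ α in Bl, X ∂μ ≤ ∫ α in Bl, (cT + |f α - cT|) ∂μ :=
    setIntegral_mono_on hconst hrhs' hBl hpt
  rw [setIntegral_const, smul_eq_mul] at hint
  have hsplit : ∫ α in Bl, (cT + |f α - cT|) ∂μ = μ.real Bl * cT + ∫ α in Bl, |f α - cT| ∂μ := by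
    rw [integral_add (integrable_const cT).integrableOn hIΔ.integrableOn, setIntegral_const, smul_eq_mul]
  have hle : ∫ α in Bl, |f α - cT| ∂μ ≤ ∫ α, |f α - cT| ∂μ :=
    setIntegral_le_integral hIΔ (Eventually.of_forall fun α => abs_nonneg _)
  rw [hsplit] at hint
  have key : μ.real Bl * X ≤ μ.real Bl * cT + ∫ α, |f α - cT| ∂μ := hint.trans (by linarith)
  have : X ≤ cT + (∫ α, |f α - cT| ∂μ) / μ.real Bl := by
    rw [add_div' _ _ _ hp.ne', le_div_iff₀ hp]
    nlinarith
  exact this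

end PerSet

section Geometry

/-- **The shear identity on sets**: `mobStep a ⁻¹' {y | a₀ - y⁻¹ ∈ J} = {s | s + (a₀ - a) ∈ J}` — the
push-forwards by `A(a)` and `A(a₀)` differ by a translation of the slope line. [folklore] -/
theorem preimage_mobStep_shear (a a₀ : ℝ) (J : Set ℝ) :
    mobStep a ⁻¹' {y | a₀ - y⁻¹ ∈ J} = {s | s + (a₀ - a) ∈ J} := by
  ext s
  simp only [mobStep, Set.mem_preimage, Set.mem_setOf_eq, inv_inv]
  rw [show a₀ - (a - s) = s + (a₀ - a) by ring]

/-- Translated intervals, upper inclusion: for `|a - a₀| < r`, the shear preimage of `Icc l u` is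
contained in `Icc (l - d - r) (u - d + r)` whenever `a₀ - a` is within `r` of `d`. [folklore] -/
theorem preimage_mobStep_shear_Icc_subset {a a₀ d r l u : ℝ} (h : |a₀ - a - d| < r) :
    mobStep a ⁻¹' {y | a₀ - y⁻¹ ∈ Set.Icc l u} ⊆ Set.Icc (l - d - r) (u - d + r) := by
  rw [preimage_mobStep_shear]
  intro s hs
  simp only [Set.mem_setOf_eq, Set.mem_Icc] at hs ⊢
  rw [abs_lt] at h
  constructor <;> linarith [hs.1, hs.2]

/-- Translated intervals, lower inclusion. [folklore] -/
theorem Icc_subset_preimage_mobStep_shear {a a₀ d r l u : ℝ} (h : |a₀ - a - d| < r) :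
    Set.Icc (l - d + r) (u - d - r) ⊆ mobStep a ⁻¹' {y | a₀ - y⁻¹ ∈ Set.Icc l u} := by
  rw [preimage_mobStep_shear]
  intro s hs
  simp only [Set.mem_setOf_eq, Set.mem_Icc] at hs ⊢
  rw [abs_lt] at h
  constructor <;> linarith [hs.1, hs.2]

/-- **Pull-back of the tail**: the slopes sent beyond `R` by `s ↦ 1/(a - s)` lie within `1/R` of the
pole `a`, hence in the window `Ioo (a₀ - r - R⁻¹) (a₀ + r + R⁻¹)` when `|a - a₀| < r`. [folklore] -/
theorem preimage_mobStep_tail_subset {a a₀ r R : ℝ} (hR : 0 < R) (h : |a - a₀| < r) :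
    mobStep a ⁻¹' {y | R < |y|} ⊆ Set.Ioo (a₀ - r - R⁻¹) (a₀ + r + R⁻¹) := by
  intro s hs
  simp only [mobStep, Set.mem_preimage, Set.mem_setOf_eq] at hs
  rw [abs_lt] at h
  have has : a - s ≠ 0 := by
    intro h0; rw [h0, inv_zero, abs_zero] at hs; exact lt_irrefl _ (hs.trans hR)
  rw [abs_inv, lt_inv_comm₀ hR (abs_pos.mpr has), abs_lt] at hs
  simp only [Set.mem_Ioo]
  constructor <;> linarith [hs.1, hs.2]

/-- Measurability of the sheared interval sets `{y | a₀ - y⁻¹ ∈ Icc l u}`. [folklore] -/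
theorem measurableSet_shear_Icc (a₀ l u : ℝ) : MeasurableSet {y : ℝ | a₀ - y⁻¹ ∈ Set.Icc l u} :=
  (measurable_const.sub measurable_inv) measurableSet_Icc

end Geometry

section Chain

/-- Two closed intervals are disjoint when their centres are further apart than the sum of their
half-widths. [folklore] -/
theorem Icc_disjoint_Icc_of_lt {c w c' w' : ℝ} (h : w + w' < |c - c'|) :
    Disjoint (Set.Icc (c - w) (c + w)) (Set.Icc (c' - w') (c' + w')) := by
  rw [Set.disjoint_left]
  intro x hx hx'
  simp only [Set.mem_Icc] at hx hx'
  have : |c - c'| ≤ w + w' := by rw [abs_le]; constructor <;> linarith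
  linarith

/-- Integrability in the site of the per-set deviation `|m_{P_{E-α}φ}(S) - m_{Pφ}(S)|`. [folklore] -/
theorem integrable_abs_mass_sub {μ : Measure ℝ} [IsProbabilityMeasure μ] {E D B : ℝ} {φ : ℝ → ℝ}
    (hD : ∀ᵐ α ∂μ, (E - α) ^ 2 + 2 ≤ D) (hφ : Measurable φ) (hφ0 : ∀ s, 0 ≤ φ s) (hφB : ∀ s, φ s ≤ B)
    {S : Set ℝ} (hS : MeasurableSet S) :
    Integrable (fun α => |(∫ y, S.indicator (fun _ => (1 : ℝ)) y * pushDensity (E - α) φ y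
      ∂(cauchyMeasure 0 1)) - ∫ y, S.indicator (fun _ => (1 : ℝ)) y * transferOp μ E φ y
        ∂(cauchyMeasure 0 1)|) μ := by
  have hB : 0 ≤ B := (hφ0 0).trans (hφB 0)
  have hmeas : Measurable fun α => |(∫ y, S.indicator (fun _ => (1 : ℝ)) y * pushDensity (E - α) φ y
      ∂(cauchyMeasure 0 1)) - ∫ y, S.indicator (fun _ => (1 : ℝ)) y * transferOp μ E φ y ∂(cauchyMeasure 0 1)| :=
    continuous_abs.measurable.comp ((measurable_mass_pushDensity (E := E) hφ hS).sub measurable_const)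
  have hind : ∀ (ψ : ℝ → ℝ) (y : ℝ), |S.indicator (fun _ => (1 : ℝ)) y * ψ y| ≤ |ψ y| := fun ψ y => by
    by_cases hy : y ∈ S <;> simp [hy]
  refine Integrable.of_bound hmeas.aestronglyMeasurable (B * D + B * D) ?_
  filter_upwards [hD] with α hα
  rw [Real.norm_eq_abs, abs_abs]
  have h1 : |∫ y, S.indicator (fun _ => (1 : ℝ)) y * pushDensity (E - α) φ y ∂(cauchyMeasure 0 1)| ≤ B * D := by
    refine abs_integral_cauchy_le fun y => (hind _ y).trans ?_
    rw [abs_of_nonneg (pushDensity_nonneg _ hφ0 y)]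
    exact (pushDensity_le _ hφ0 hφB y).trans (mul_le_mul_of_nonneg_left hα hB)
  have h2 : |∫ y, S.indicator (fun _ => (1 : ℝ)) y * transferOp μ E φ y ∂(cauchyMeasure 0 1)| ≤ B * D := by
    refine abs_integral_cauchy_le fun y => (hind _ y).trans ?_
    rw [abs_of_nonneg (transferOp_nonneg hφ0 y)]
    exact transferOp_le hD hφ0 hφB y
  exact (abs_sub _ _).trans (add_le_add h1 h2)

/-- **Four disjoint translates**: if a probability density `ψ` satisfies the fattened translation
sub-invariance `m_ψ(Icc (l-t+r) (u-t-r)) ≤ m_ψ(Icc (l-r) (u+r)) + δ₁` for all `l, u`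
(`t ≠ 0`, `r = |t|/32`, `R = 4/|t|`, `k ≥ 12/t² + 1`), then `m_ψ([-R, R]) ≤ 1/4 + (3/2) k δ₁`:
the translates `L_j = jt + [-R - 2jr, R + 2jr]`, `j ∈ {0, k, 2k, 3k}`, are pairwise disjoint and
`m_ψ(L_0) ≤ m_ψ(L_j) + j δ₁`. [folklore] -/
theorem mass_Icc_le_of_shift_subinvariant {ψ : ℝ → ℝ} (hψ0 : ∀ s, 0 ≤ ψ s)
    (hψi : Integrable ψ (cauchyMeasure 0 1)) (hψ1 : ∫ s, ψ s ∂(cauchyMeasure 0 1) = 1)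
    {t r R δ₁ : ℝ} (ht : t ≠ 0) (hr : r = |t| / 32) (hRt : R = 4 / |t|) {k : ℕ}
    (hk : 12 / t ^ 2 + 1 ≤ k)
    (hstep : ∀ l u : ℝ,
      ∫ s, (Set.Icc (l - t + r) (u - t - r)).indicator (fun _ => (1 : ℝ)) s * ψ s ∂(cauchyMeasure 0 1) ≤
        (∫ s, (Set.Icc (l - r) (u + r)).indicator (fun _ => (1 : ℝ)) s * ψ s ∂(cauchyMeasure 0 1)) + δ₁) :
    ∫ s, (Set.Icc (-R) R).indicator (fun _ => (1 : ℝ)) s * ψ s ∂(cauchyMeasure 0 1) ≤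
      1 / 4 + 3 / 2 * k * δ₁ := by
  have hT : 0 < |t| := abs_pos.mpr ht
  have ht2 : 0 < t ^ 2 := by positivity
  -- the translates
  set L : ℕ → Set ℝ := fun j => Set.Icc ((j : ℝ) * t - (R + 2 * j * r)) ((j : ℝ) * t + (R + 2 * j * r))
    with hL
  set M : Set ℝ → ℝ := fun S => ∫ s, S.indicator (fun _ => (1 : ℝ)) s * ψ s ∂(cauchyMeasure 0 1) with hM
  have hLmeas : ∀ j, MeasurableSet (L j) := fun j => measurableSet_Icc
  -- one step of the chain
  have hchain1 : ∀ j : ℕ, M (L j) ≤ M (L (j + 1)) + δ₁ := by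
    intro j
    have h := hstep (((j : ℝ) + 1) * t - (R + 2 * ((j : ℝ) + 1) * r) + r)
      (((j : ℝ) + 1) * t + (R + 2 * ((j : ℝ) + 1) * r) - r)
    have e1 : Set.Icc (((j : ℝ) + 1) * t - (R + 2 * ((j : ℝ) + 1) * r) + r - t + r)
        (((j : ℝ) + 1) * t + (R + 2 * ((j : ℝ) + 1) * r) - r - t - r) = L j := by
      simp only [hL]; congr 1 <;> ring
    have e2 : Set.Icc (((j : ℝ) + 1) * t - (R + 2 * ((j : ℝ) + 1) * r) + r - r)
        (((j : ℝ) + 1) * t + (R + 2 * ((j : ℝ) + 1) * r) - r + r) = L (j + 1) := by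
      simp only [hL]; push_cast; congr 1 <;> ring
    rw [e1, e2] at h
    exact h
  have hchain : ∀ j : ℕ, M (L 0) ≤ M (L j) + j * δ₁ := by
    intro j
    induction j with
    | zero => simp
    | succ j ih =>
      have := hchain1 j
      push_cast
      linarith
  -- disjointness of L 0, L k, L 2k, L 3k
  have hkt : 12 < (k : ℝ) * t ^ 2 := by
    have h1 : 12 / t ^ 2 < k := by linarith
    rwa [div_lt_iff₀ ht2] at h1
  have hk0 : (0 : ℝ) < k := by
    have : (0 : ℝ) < 12 / t ^ 2 + 1 := by positivity
    linarith
  have hdisj : Set.Pairwise (↑(Finset.range 4)) (Function.onFun Disjoint fun i : ℕ => L (i * k)) := by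
    intro i hi i' hi' hne
    have hi4 : i < 4 := by simpa using hi
    have hi'4 : i' < 4 := by simpa using hi'
    show Disjoint (L (i * k)) (L (i' * k))
    simp only [hL]
    refine Icc_disjoint_Icc_of_lt ?_
    have hsum : ((i : ℝ) + i') ≤ 5 := by
      have : i + i' ≤ 5 := by omega
      exact_mod_cast this
    have hdiff : (1 : ℝ) ≤ |(i : ℝ) - i'| := by
      rcases Nat.lt_or_gt_of_ne hne with h | h
      · have : (i : ℝ) + 1 ≤ i' := by exact_mod_cast h
        rw [abs_sub_comm, abs_of_nonneg (by linarith)]; linarith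
      · have : (i' : ℝ) + 1 ≤ i := by exact_mod_cast h
        rw [abs_of_nonneg (by linarith)]; linarith
    have hcent : (k : ℝ) * |t| ≤ |((i * k : ℕ) : ℝ) * t - ((i' * k : ℕ) : ℝ) * t| := by
      push_cast
      rw [show (i : ℝ) * k * t - i' * k * t = ((i : ℝ) - i') * (k * t) by ring, abs_mul, abs_mul,
        abs_of_pos hk0]
      calc (k : ℝ) * |t| = 1 * (k * |t|) := by ring
        _ ≤ |(i : ℝ) - i'| * (k * |t|) := mul_le_mul_of_nonneg_right hdiff (by positivity)
    have hwid : R + 2 * ((i * k : ℕ) : ℝ) * r + (R + 2 * ((i' * k : ℕ) : ℝ) * r) ≤ 2 * R + 10 * k * r := by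
      push_cast
      have hr0 : 0 ≤ r := by rw [hr]; positivity
      nlinarith [mul_nonneg hk0.le hr0]
    have hgap : 2 * R + 10 * k * r < k * |t| := by
      rw [hRt, hr]
      have htt : |t| * |t| = t ^ 2 := by rw [← sq, sq_abs]
      have h1 : 2 * (4 / |t|) = 8 / |t| := by ring
      have h2 : 8 / |t| < k * |t| * (22 / 32) := by
        rw [div_lt_iff₀ hT]; nlinarith [htt, hkt]
      rw [h1]
      linarith
    linarith
  -- sum of the four masses ≤ 1
  have hsum := sum_integral_indicator_one_mul_le hψ0 hψi (Finset.range 4) (S := fun i : ℕ => L (i * k))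
    (fun i _ => hLmeas _) hdisj
  rw [hψ1] at hsum
  have hsum' : ∑ i ∈ Finset.range 4, M (L (i * k)) ≤ 1 := hsum
  have hlow : ∀ i : ℕ, M (L 0) - i * k * δ₁ ≤ M (L (i * k)) := by
    intro i
    have := hchain (i * k)
    push_cast at this
    linarith
  have h4 : 4 * M (L 0) - 6 * k * δ₁ ≤ 1 := by
    have := Finset.sum_le_sum fun i (_ : i ∈ Finset.range 4) => hlow i
    simp only [Finset.sum_range_succ, Finset.sum_range_zero] at this hsum'
    push_cast at this
    linarith
  have hL0 : L 0 = Set.Icc (-R) R := by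
    simp only [hL]; push_cast; congr 1 <;> ring
  rw [← hL0]
  show M (L 0) ≤ 1 / 4 + 3 / 2 * k * δ₁
  linarith

end Chain

section TwoStep

variable {μ : Measure ℝ} {E D : ℝ}

/-- A ball around a point of the support has positive mass. [folklore] -/
theorem measureReal_ball_pos_of_mem_support [IsFiniteMeasure μ] {x : ℝ} (hx : x ∈ μ.support) {r : ℝ}
    (hr : 0 < r) : 0 < μ.real (Metric.ball x r) := by
  have h := (Measure.mem_support_iff_forall x).mp hx (Metric.ball x r) (Metric.ball_mem_nhds x hr)
  rw [measureReal_def]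
  exact ENNReal.toReal_pos h.ne' (measure_ne_top μ _)

/-- The tail set is the complement of the central interval. [folklore] -/
theorem setOf_lt_abs_eq_compl_Icc (R : ℝ) : {y : ℝ | R < |y|} = (Set.Icc (-R) R)ᶜ := by
  ext y
  simp only [Set.mem_setOf_eq, Set.mem_compl_iff, Set.mem_Icc, ← abs_le, not_le]

/-- **Two-step non-invariance for an arbitrary single-site law** (the input replacing
`hellinger_variance_lower`): if the support of `μ` contains two points then there is `r₀ > 0`,
depending on `μ` only, such that for EVERY probability density `0 < φ ≤ B` (against the Cauchy
measure) the Hellinger variances of two consecutive steps satisfy `V(φ) + V(Pφ) ≥ r₀`,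
`V(φ) = ∫∫ (√(P_{E-α}φ) - √(Pφ))² dm dμ`.  (For a single step `inf_φ V(φ) = 0`: all `A(a)` send the
vertical direction to the horizontal one; two steps see the shears `A(a')⁻¹A(a)`, `A(a)A(a')⁻¹` with
distinct fixed points — Fürstenberg's / Gorodetski–Kleptsyn's condition for the two-step law.)
[cite: GorodetskiKleptsyn2022, Thm 1.5 & Rem. 1.9] -/
theorem exists_hellinger_two_step_lower [IsProbabilityMeasure μ] (hD : ∀ᵐ α ∂μ, (E - α) ^ 2 + 2 ≤ D)
    (hD1 : 1 ≤ D) (hnt : μ.support.Nontrivial) :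
    ∃ r₀ : ℝ, 0 < r₀ ∧ ∀ (φ : ℝ → ℝ) (B : ℝ), Measurable φ → (∀ s, 0 < φ s) → (∀ s, φ s ≤ B) →
      1 ≤ B → ∫ s, φ s ∂(cauchyMeasure 0 1) = 1 →
      r₀ ≤ (∫ α, ∫ y, (Real.sqrt (pushDensity (E - α) φ y) - Real.sqrt (transferOp μ E φ y)) ^ 2
          ∂(cauchyMeasure 0 1) ∂μ) +
        ∫ α, ∫ y, (Real.sqrt (pushDensity (E - α) (transferOp μ E φ) y) -
          Real.sqrt (transferOp μ E (transferOp μ E φ) y)) ^ 2 ∂(cauchyMeasure 0 1) ∂μ := by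
  obtain ⟨a₀, ha₀, b₀, hb₀, hab⟩ := hnt
  -- the constants
  set t : ℝ := b₀ - a₀ with htdef
  have ht : t ≠ 0 := sub_ne_zero.mpr (Ne.symm hab)
  have hT : 0 < |t| := abs_pos.mpr ht
  set r : ℝ := |t| / 32 with hrdef
  have hr : 0 < r := by positivity
  set R : ℝ := 4 / |t| with hRdef
  have hR : 0 < R := by positivity
  have hRinv : R⁻¹ = |t| / 4 := by rw [hRdef, inv_div]
  set k : ℕ := ⌈12 / t ^ 2⌉₊ + 1 with hkdef
  have hk : 12 / t ^ 2 + 1 ≤ (k : ℝ) := by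
    rw [hkdef]; push_cast; linarith [Nat.le_ceil (12 / t ^ 2)]
  have hk0 : (0 : ℝ) ≤ k := Nat.cast_nonneg k
  have hpa : 0 < μ.real (Metric.ball a₀ r) := measureReal_ball_pos_of_mem_support ha₀ hr
  have hpb : 0 < μ.real (Metric.ball b₀ r) := measureReal_ball_pos_of_mem_support hb₀ hr
  set p : ℝ := min (μ.real (Metric.ball a₀ r)) (μ.real (Metric.ball b₀ r)) with hpdef
  have hp : 0 < p := lt_min hpa hpb
  set δ₁ : ℝ := 1 / (4 * (3 * k + 1)) with hδ₁def
  have hδ₁ : 0 < δ₁ := by positivity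
  have hδ₁val : 3 * ((k : ℝ) * δ₁) + δ₁ = 1 / 4 := by
    have : (3 * (k : ℝ) + 1) ≠ 0 := by positivity
    rw [hδ₁def]; field_simp
  set δ₀ : ℝ := δ₁ * p / 2 with hδ₀def
  have hδ₀ : 0 < δ₀ := by positivity
  have herr_a : δ₀ / μ.real (Metric.ball a₀ r) ≤ δ₁ / 2 := by
    rw [div_le_iff₀ hpa, hδ₀def]
    have : p ≤ μ.real (Metric.ball a₀ r) := min_le_left _ _
    nlinarith
  have herr_b : δ₀ / μ.real (Metric.ball b₀ r) ≤ δ₁ / 2 := by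
    rw [div_le_iff₀ hpb, hδ₀def]
    have : p ≤ μ.real (Metric.ball b₀ r) := min_le_right _ _
    nlinarith
  have hquot : δ₀ ^ 2 / 4 / (δ₀ / 2) = δ₀ / 2 := by field_simp; ring
  refine ⟨δ₀ ^ 2 / 4, by positivity, ?_⟩
  intro φ B hφ hφ0 hφB hB hφ1
  by_contra hlt
  rw [not_le] at hlt
  -- the two densities φ and Pφ
  have hφ0' : ∀ s, 0 ≤ φ s := fun s => (hφ0 s).le
  have hφ'm : Measurable (transferOp μ E φ) := measurable_transferOp hφ
  have hφ'0 : ∀ s, 0 < transferOp μ E φ s := transferOp_pos hD hφ hφ0 hφB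
  have hφ'B : ∀ s, transferOp μ E φ s ≤ B * D := transferOp_le hD hφ0' hφB
  have hBD : 1 ≤ B * D := one_le_mul_of_one_le_of_one_le hB hD1
  have hφ'1 : ∫ s, transferOp μ E φ s ∂(cauchyMeasure 0 1) = 1 := by
    rw [integral_transferOp hD hφ hφ0' hφB, hφ1]
  have hφ'0' : ∀ s, 0 ≤ transferOp μ E φ s := fun s => (hφ'0 s).le
  have hφi : Integrable φ (cauchyMeasure 0 1) :=
    integrable_cauchy_of_bound hφ B fun s => by rw [abs_of_pos (hφ0 s)]; exact hφB s
  have hφ'i : Integrable (transferOp μ E φ) (cauchyMeasure 0 1) :=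
    integrable_cauchy_of_bound hφ'm (B * D) fun s => by rw [abs_of_pos (hφ'0 s)]; exact hφ'B s
  -- both Hellinger variances are ≤ δ₀²/4
  have hV0 : 0 ≤ ∫ α, ∫ y, (Real.sqrt (pushDensity (E - α) φ y) - Real.sqrt (transferOp μ E φ y)) ^ 2
      ∂(cauchyMeasure 0 1) ∂μ := integral_nonneg fun α => integral_nonneg fun y => sq_nonneg _
  have hV'0 : 0 ≤ ∫ α, ∫ y, (Real.sqrt (pushDensity (E - α) (transferOp μ E φ) y) -
      Real.sqrt (transferOp μ E (transferOp μ E φ) y)) ^ 2 ∂(cauchyMeasure 0 1) ∂μ :=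
    integral_nonneg fun α => integral_nonneg fun y => sq_nonneg _
  have hVlt : (∫ α, ∫ y, (Real.sqrt (pushDensity (E - α) φ y) - Real.sqrt (transferOp μ E φ y)) ^ 2
      ∂(cauchyMeasure 0 1) ∂μ) ≤ δ₀ ^ 2 / 4 := by linarith
  have hV'lt : (∫ α, ∫ y, (Real.sqrt (pushDensity (E - α) (transferOp μ E φ) y) -
      Real.sqrt (transferOp μ E (transferOp μ E φ) y)) ^ 2 ∂(cauchyMeasure 0 1) ∂μ) ≤ δ₀ ^ 2 / 4 := by
    linarith
  -- per-set deviations ≤ δ₀, for both transitions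
  have hΔ : ∀ S : Set ℝ, MeasurableSet S →
      ∫ α, |(∫ y, S.indicator (fun _ => (1 : ℝ)) y * pushDensity (E - α) φ y ∂(cauchyMeasure 0 1)) -
        ∫ y, S.indicator (fun _ => (1 : ℝ)) y * transferOp μ E φ y ∂(cauchyMeasure 0 1)| ∂μ ≤ δ₀ := by
    intro S hS
    have h := integral_abs_mass_sub_le hD hφ hφ0 hφB hB hφ1 hS (c := δ₀ / 2) (by positivity)
    refine h.trans ?_
    have h' := div_le_div_of_nonneg_right hVlt (by positivity : (0 : ℝ) ≤ δ₀ / 2)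
    rw [hquot] at h'
    linarith
  have hΔ' : ∀ S : Set ℝ, MeasurableSet S →
      ∫ α, |(∫ y, S.indicator (fun _ => (1 : ℝ)) y * pushDensity (E - α) (transferOp μ E φ) y
        ∂(cauchyMeasure 0 1)) - ∫ y, S.indicator (fun _ => (1 : ℝ)) y *
          transferOp μ E (transferOp μ E φ) y ∂(cauchyMeasure 0 1)| ∂μ ≤ δ₀ := by
    intro S hS
    have h := integral_abs_mass_sub_le hD hφ'm hφ'0 hφ'B hBD hφ'1 hS (c := δ₀ / 2) (by positivity)
    refine h.trans ?_
    have h' := div_le_div_of_nonneg_right hV'lt (by positivity : (0 : ℝ) ≤ δ₀ / 2)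
    rw [hquot] at h'
    linarith
  -- ball membership in terms of the poles
  have hball_a : ∀ α ∈ Metric.ball a₀ r, |(E - a₀) - (E - α) - 0| < r := by
    intro α hα
    rw [Metric.mem_ball, Real.dist_eq] at hα
    rw [show (E - a₀) - (E - α) - 0 = α - a₀ by ring]; exact hα
  have hball_b : ∀ α ∈ Metric.ball b₀ r, |(E - a₀) - (E - α) - t| < r := by
    intro α hα
    rw [Metric.mem_ball, Real.dist_eq] at hα
    rw [show (E - a₀) - (E - α) - t = α - b₀ by rw [htdef]; ring]; exact hα
  -- Step 1: fattened translation sub-invariance of Pφ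
  have hstep : ∀ l u : ℝ,
      ∫ s, (Set.Icc (l - t + r) (u - t - r)).indicator (fun _ => (1 : ℝ)) s * transferOp μ E φ s
          ∂(cauchyMeasure 0 1) ≤
        (∫ s, (Set.Icc (l - r) (u + r)).indicator (fun _ => (1 : ℝ)) s * transferOp μ E φ s
          ∂(cauchyMeasure 0 1)) + δ₁ := by
    intro l u
    have hS : MeasurableSet {y : ℝ | (E - a₀) - y⁻¹ ∈ Set.Icc l u} := measurableSet_shear_Icc _ l u
    have hI := integrable_abs_mass_sub hD hφ'm hφ'0' hφ'B hS
    have hlow := mass_le_mass_transferOp_of_forall_mem (μ := μ) (E := E) hφ'0' hφ'i hS measurableSet_Icc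
      Metric.isOpen_ball.measurableSet hpb (S'' := Set.Icc (l - t + r) (u - t - r))
      (fun α hα => Icc_subset_preimage_mobStep_shear (hball_b α hα)) hI
    have hup := mass_transferOp_le_of_forall_mem (μ := μ) (E := E) hφ'0' hφ'i hS measurableSet_Icc
      Metric.isOpen_ball.measurableSet hpa (S' := Set.Icc (l - r) (u + r))
      (fun α hα => by
        have := preimage_mobStep_shear_Icc_subset (l := l) (u := u) (hball_a α hα)
        simpa only [sub_zero] using this) hI
    have h1 := hΔ' _ hS
    have e1 := (div_le_div_of_nonneg_right h1 hpb.le).trans herr_b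
    have e2 := (div_le_div_of_nonneg_right h1 hpa.le).trans herr_a
    linarith
  -- Step 2: four disjoint translates
  have hcentral := mass_Icc_le_of_shift_subinvariant hφ'0' hφ'i hφ'1 ht rfl rfl hk hstep
  -- Step 3: the tail of Pφ is large ...
  have htail : 3 / 4 - 3 / 2 * k * δ₁ ≤
      ∫ y, {y : ℝ | R < |y|}.indicator (fun _ => (1 : ℝ)) y * transferOp μ E φ y ∂(cauchyMeasure 0 1) := by
    have hc := integral_indicator_one_mul_add_compl hφ'i (measurableSet_Icc (a := -R) (b := R))
    rw [hφ'1, ← setOf_lt_abs_eq_compl_Icc R] at hc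
    linarith
  -- ... and pulls back into the two windows
  have hSt : MeasurableSet {y : ℝ | R < |y|} := measurableSet_lt measurable_const continuous_abs.measurable
  have hIt := integrable_abs_mass_sub hD hφ hφ0' hφB hSt
  have hwin_a := mass_transferOp_le_of_forall_mem (μ := μ) (E := E) hφ0' hφi hSt measurableSet_Ioo
    Metric.isOpen_ball.measurableSet hpa (S' := Set.Ioo ((E - a₀) - r - R⁻¹) ((E - a₀) + r + R⁻¹))
    (fun α hα => preimage_mobStep_tail_subset hR (by
      rw [Metric.mem_ball, Real.dist_eq] at hα
      rw [show E - α - (E - a₀) = -(α - a₀) by ring, abs_neg]; exact hα)) hIt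
  have hwin_b := mass_transferOp_le_of_forall_mem (μ := μ) (E := E) hφ0' hφi hSt measurableSet_Ioo
    Metric.isOpen_ball.measurableSet hpb (S' := Set.Ioo ((E - b₀) - r - R⁻¹) ((E - b₀) + r + R⁻¹))
    (fun α hα => preimage_mobStep_tail_subset hR (by
      rw [Metric.mem_ball, Real.dist_eq] at hα
      rw [show E - α - (E - b₀) = -(α - b₀) by ring, abs_neg]; exact hα)) hIt
  have h2 := hΔ _ hSt
  have ea := (div_le_div_of_nonneg_right h2 hpa.le).trans herr_a
  have eb := (div_le_div_of_nonneg_right h2 hpb.le).trans herr_b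
  -- the windows are disjoint, so their masses add up to at most 1
  have hdisjW : Set.Ioo ((E - a₀) - r - R⁻¹) ((E - a₀) + r + R⁻¹) ⊆
      (Set.Ioo ((E - b₀) - r - R⁻¹) ((E - b₀) + r + R⁻¹))ᶜ := by
    intro x hxa hxb
    simp only [Set.mem_Ioo] at hxa hxb
    have h9 : 2 * (r + R⁻¹) < |t| := by rw [hRinv, hrdef]; linarith
    have : |(E - a₀) - (E - b₀)| < 2 * (r + R⁻¹) := by
      rw [abs_lt]; constructor <;> linarith
    rw [show (E - a₀) - (E - b₀) = t by rw [htdef]; ring] at this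
    linarith
  have hmono := integral_indicator_one_mul_mono hφ0' hφi measurableSet_Ioo measurableSet_Ioo.compl hdisjW
  have hcompl := integral_indicator_one_mul_add_compl hφi (measurableSet_Ioo (a := (E - b₀) - r - R⁻¹)
    (b := (E - b₀) + r + R⁻¹))
  rw [hφ1] at hcompl
  -- final count: 2 (3/4 - 3/2 k δ₁ - δ₁/2) ≤ 1, i.e. 1/2 ≤ (3k+1) δ₁ = 1/4
  linarith

end TwoStep

section Assembly

variable {μ : Measure ℝ} {R : ℝ}

/-- **The finite-volume lower bound for an arbitrary single-site law** (replaces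
`andersonLogNormAvg_ge`): if the support of `μ` is bounded and contains two points then there is
`c > 0` with `n⁻¹ 𝔼 log ‖M_n^E‖ ≥ c` for all `n ≥ 2` — entropy production (`entropy_step`) summed
along the slope chain (`integral_log_norm_chainVec`), consecutive steps being paired through
`exists_hellinger_two_step_lower`. [cite: BucajEtAl2019, Thm 2.3] -/
theorem andersonLogNormAvg_ge_of_nontrivial [IsProbabilityMeasure μ] (hR : ∀ᵐ x ∂μ, |x| ≤ R)
    (hnt : μ.support.Nontrivial) (E : ℝ) :
    ∃ c : ℝ, 0 < c ∧ ∀ n : ℕ, 2 ≤ n → c ≤ andersonLogNormAvg μ E n := by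
  set D := (|E| + R) ^ 2 + 2 with hDdef
  have hD : ∀ᵐ α ∂μ, (E - α) ^ 2 + 2 ≤ D := ae_sq_add_two_le hR E
  have hD1 : 1 ≤ D := by rw [hDdef]; nlinarith [sq_nonneg (|E| + R)]
  have hD0 : 0 ≤ D := zero_le_one.trans hD1
  obtain ⟨r₀, hr₀, hlow⟩ := exists_hellinger_two_step_lower (μ := μ) (E := E) hD hD1 hnt
  refine ⟨r₀ / 6, by positivity, fun n hn => ?_⟩
  -- the densities
  have hmeas := fun k => measurable_iterDensity (μ := μ) (E := E) k
  have hposφ := fun k => iterDensity_pos (μ := μ) (E := E) hD k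
  have hleφ := fun k => iterDensity_le (μ := μ) (E := E) hD k
  have hmass := fun k => integral_iterDensity (μ := μ) (E := E) hD k
  have hBk : ∀ k : ℕ, (1 : ℝ) ≤ D ^ k := fun k => one_le_pow₀ hD1
  -- per-step quantities
  set I2 : ℕ → ℝ := fun k => ∫ a, ∫ y, Real.log (stepJac (E - a) y) * iterDensity μ E k y
    ∂(cauchyMeasure 0 1) ∂μ with hI2
  set H : ℕ → ℝ := fun k => ∫ s, iterDensity μ E k s * Real.log (iterDensity μ E k s) ∂(cauchyMeasure 0 1)
    with hH
  set Rk : ℕ → ℝ := fun k => ∫ a, ∫ y, (Real.sqrt (pushDensity (E - a) (iterDensity μ E k) y) -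
    Real.sqrt (iterDensity μ E (k + 1) y)) ^ 2 ∂(cauchyMeasure 0 1) ∂μ with hRk
  have hstep : ∀ k, H (k + 1) - H k + Rk k ≤ I2 k := fun k =>
    entropy_step hD hD1 (hmeas k) (hposφ k) (hleφ k) (hBk k)
  have hRk0 : ∀ k, 0 ≤ Rk k := fun k => integral_nonneg fun _ => integral_nonneg fun _ => sq_nonneg _
  have hpair : ∀ j : ℕ, r₀ ≤ Rk (2 * j) + Rk (2 * j + 1) := fun j =>
    hlow (iterDensity μ E (2 * j)) (D ^ (2 * j)) (hmeas _) (hposφ _) (hleφ _) (hBk _) (hmass _)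
  -- pairing consecutive steps
  have hsum2 : ∀ m : ℕ, (m : ℝ) * r₀ ≤ ∑ k ∈ Finset.range (2 * m), Rk k := by
    intro m
    induction m with
    | zero => simp
    | succ m ih =>
      rw [show 2 * (m + 1) = 2 * m + 1 + 1 by ring, Finset.sum_range_succ, Finset.sum_range_succ]
      have := hpair m
      push_cast
      linarith
  have hsumR : ((n / 2 : ℕ) : ℝ) * r₀ ≤ ∑ k ∈ Finset.range n, Rk k := by
    refine (hsum2 (n / 2)).trans ?_
    apply Finset.sum_le_sum_of_subset_of_nonneg (Finset.range_mono (Nat.mul_div_le n 2))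
    intro k _ _
    exact hRk0 k
  have hhalf : (n : ℝ) ≤ 3 * ((n / 2 : ℕ) : ℝ) := by
    have : n ≤ 3 * (n / 2) := by omega
    exact_mod_cast this
  have hH0 : H 0 = 0 := by simp [hH, iterDensity]
  have hHn : 0 ≤ H n := integral_mul_log_nonneg (hmeas n) (hposφ n) (hleφ n) (hBk n) (hmass n)
  -- summation
  have hsum : ((n / 2 : ℕ) : ℝ) * r₀ ≤ ∑ k ∈ Finset.range n, I2 k := by
    have h1 : ∑ k ∈ Finset.range n, (H (k + 1) - H k + Rk k) ≤ ∑ k ∈ Finset.range n, I2 k :=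
      Finset.sum_le_sum fun k _ => hstep k
    rw [Finset.sum_add_distrib, Finset.sum_range_sub, hH0, sub_zero] at h1
    linarith
  -- the link with the matrix norms (as in `andersonLogNormAvg_ge`)
  have hlink := integral_log_norm_chainVec (μ := μ) hD hD1 n
  have hbox : ∀ᵐ z ∂(Measure.pi fun _ : Fin n => μ), ∀ k, k < n → |E - padSeq z k| ≤ D := by
    have h := ae_pi_forall (μ := μ) (P := fun a => (E - a) ^ 2 + 2 ≤ D)
      (measurableSet_le (by fun_prop) measurable_const) hD n
    filter_upwards [h] with z hz
    intro k hk
    rw [padSeq_of_lt z hk]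
    have := hz ⟨k, hk⟩
    have := abs_le_sq_add_one (E - z ⟨k, hk⟩)
    linarith
  have hQm : Measurable fun x : Fin n → ℝ => ∫ s, (Real.log ‖chainVec E x n s‖ - Real.log ‖baseVec s‖)
      ∂(cauchyMeasure 0 1) :=
    ((measurable_log_norm_chainVec_sub E n n).stronglyMeasurable.integral_prod_right'
      (ν := cauchyMeasure 0 1)).measurable
  have hQI : Integrable (fun x : Fin n → ℝ => ∫ s, (Real.log ‖chainVec E x n s‖ - Real.log ‖baseVec s‖)
      ∂(cauchyMeasure 0 1)) (Measure.pi fun _ : Fin n => μ) := by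
    refine Integrable.of_bound hQm.aestronglyMeasurable ((n : ℕ) * Real.log (D + 1)) ?_
    filter_upwards [hbox] with z hz
    rw [Real.norm_eq_abs]
    exact abs_integral_cauchy_le fun s => abs_log_norm_chainVec_sub_le E hD0 z hz s
  have hNm : Measurable fun x : Fin n → ℝ => Real.log ‖andersonTransferProd E (padSeq x) n‖ :=
    (continuous_norm.comp (continuous_andersonTransferProd E n)).measurable.log
  have hNI : Integrable (fun x : Fin n → ℝ => Real.log ‖andersonTransferProd E (padSeq x) n‖)
      (Measure.pi fun _ : Fin n => μ) := by
    refine Integrable.of_bound hNm.aestronglyMeasurable ((n : ℕ) * Real.log (D + 1)) ?_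
    filter_upwards [hbox] with z hz
    have h1 := norm_andersonTransferProd_le E hD0 (padSeq z) n hz
    have h0 := one_le_norm_of_det_eq_one _ (det_andersonTransferProd E (padSeq z) n)
    rw [Real.norm_eq_abs, abs_of_nonneg (Real.log_nonneg h0), ← Real.log_pow]
    exact Real.log_le_log (by linarith) h1
  have hupper : ∫ x, ∫ s, (Real.log ‖chainVec E x n s‖ - Real.log ‖baseVec s‖) ∂(cauchyMeasure 0 1)
      ∂(Measure.pi fun _ : Fin n => μ) ≤ ∫ x, Real.log ‖andersonTransferProd E (padSeq x) n‖
        ∂(Measure.pi fun _ : Fin n => μ) :=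
    integral_mono hQI hNI fun x => integral_log_norm_chainVec_sub_le E x
  -- conclude
  have hn0 : (0 : ℝ) < n := by exact_mod_cast (lt_of_lt_of_le (by norm_num) hn)
  unfold andersonLogNormAvg
  rw [hlink] at hupper
  have key : (n : ℝ) * r₀ / 6 ≤ ∫ x, Real.log ‖andersonTransferProd E (padSeq x) n‖
      ∂(Measure.pi fun _ : Fin n => μ) := by nlinarith
  calc r₀ / 6 = 1 / (n : ℝ) * ((n : ℝ) * r₀ / 6) := by field_simp
    _ ≤ 1 / (n : ℝ) * ∫ x, Real.log ‖andersonTransferProd E (padSeq x) n‖ ∂(Measure.pi fun _ : Fin n => μ) :=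
        mul_le_mul_of_nonneg_left key (by positivity)

/-- **The one-step average is positive**: `𝔼 log ‖M^E(α)‖ > 0` as soon as the support of the site law
is bounded and contains two points (`‖M^E(α)‖ ≥ ‖M^E(α)(1,0)ᵀ‖ = √((E-α)²+1) > 1` off `α = E`).
[folklore] -/
theorem andersonLogNormAvg_one_pos [IsProbabilityMeasure μ] (hR : ∀ᵐ x ∂μ, |x| ≤ R)
    (hnt : μ.support.Nontrivial) (E : ℝ) : 0 < andersonLogNormAvg μ E 1 := by
  obtain ⟨a₀, ha₀, b₀, hb₀, hab⟩ := hnt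
  set D := (|E| + R) ^ 2 + 2 with hDdef
  have hD : ∀ᵐ α ∂μ, (E - α) ^ 2 + 2 ≤ D := ae_sq_add_two_le hR E
  have hD1 : 1 ≤ D := by rw [hDdef]; nlinarith [sq_nonneg (|E| + R)]
  have hD0 : 0 ≤ D := zero_le_one.trans hD1
  -- a support point at distance ≥ |a₀ - b₀|/2 from E
  have hab' : 0 < |a₀ - b₀| := abs_pos.mpr (sub_ne_zero.mpr hab)
  obtain ⟨c, hc, hcE⟩ : ∃ c ∈ μ.support, |a₀ - b₀| / 2 ≤ |E - c| := by
    by_cases h : |a₀ - b₀| / 2 ≤ |E - a₀|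
    · exact ⟨a₀, ha₀, h⟩
    · refine ⟨b₀, hb₀, ?_⟩
      have : |a₀ - b₀| ≤ |E - a₀| + |E - b₀| := by
        calc |a₀ - b₀| = |(E - b₀) - (E - a₀)| := by ring_nf
          _ ≤ |E - b₀| + |E - a₀| := abs_sub _ _
          _ = |E - a₀| + |E - b₀| := by ring
      rw [not_le] at h
      linarith
  set ρ := |a₀ - b₀| / 4 with hρdef
  have hρ : 0 < ρ := by positivity
  set η := (1 / 2 : ℝ) * Real.log (ρ ^ 2 + 1) with hηdef
  have hη : 0 < η := by
    have : 1 < ρ ^ 2 + 1 := by nlinarith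
    have := Real.log_pos this
    positivity
  -- pointwise lower bound on log ‖M^E(a)‖
  have hlogM : ∀ a : ℝ, (1 / 2 : ℝ) * Real.log ((E - a) ^ 2 + 1) ≤ Real.log ‖andersonTransfer E a‖ := by
    intro a
    have hv : baseVec 0 0 ≠ 0 := by simp
    have h1 := log_norm_andersonTransfer_apply_sub E a hv
    rw [slope_baseVec] at h1
    have hJ : stepJac (E - a) 0 = (E - a) ^ 2 + 1 := by simp [stepJac]
    rw [hJ] at h1
    have hvn : ‖baseVec 0‖ = 1 := by
      have : ‖baseVec 0‖ ^ 2 = 1 := by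
        rw [EuclideanSpace.real_norm_sq_eq]; simp [Fin.sum_univ_two]
      have h0 := norm_nonneg (baseVec 0)
      nlinarith
    have hle := norm_toEuclideanLin_apply_le (andersonTransfer E a) (baseVec 0)
    rw [hvn, mul_one] at hle
    rw [hvn, Real.log_one, sub_zero] at h1
    have hpos : 0 < ‖Matrix.toEuclideanLin (andersonTransfer E a) (baseVec 0)‖ := by
      have hsq := norm_sq_andersonTransfer_apply E a hv
      have hJp := stepJac_pos (E - a) (slope (baseVec 0))
      have hb := norm_baseVec_pos 0
      have h2 : 0 < ‖Matrix.toEuclideanLin (andersonTransfer E a) (baseVec 0)‖ ^ 2 := by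
        rw [hsq]; positivity
      rcases (norm_nonneg (Matrix.toEuclideanLin (andersonTransfer E a) (baseVec 0))).lt_or_eq with h | h
      · exact h
      · rw [← h] at h2; norm_num at h2
    rw [← h1]
    exact Real.log_le_log hpos hle
  -- on the ball around c the bound is at least η
  have hball : ∀ a ∈ Metric.ball c ρ, η ≤ Real.log ‖andersonTransfer E a‖ := by
    intro a ha
    rw [Metric.mem_ball, Real.dist_eq] at ha
    refine le_trans ?_ (hlogM a)
    rw [hηdef]
    have hEa : ρ ≤ |E - a| := by
      have := abs_sub_abs_le_abs_sub (E - c) (a - c)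
      rw [show E - c - (a - c) = E - a by ring] at this
      have h4 : |a₀ - b₀| / 2 = 2 * ρ := by rw [hρdef]; ring
      linarith
    have hsq : ρ ^ 2 ≤ (E - a) ^ 2 := by
      rw [← sq_abs (E - a)]; exact pow_le_pow_left₀ hρ.le hEa 2
    have := Real.log_le_log (by positivity) (by linarith : ρ ^ 2 + 1 ≤ (E - a) ^ 2 + 1)
    linarith
  -- integrate
  have hMpos : ∀ a, 0 ≤ Real.log ‖andersonTransfer E a‖ := fun a =>
    le_trans (by
      have := Real.log_nonneg (by nlinarith : (1 : ℝ) ≤ (E - a) ^ 2 + 1); positivity) (hlogM a)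
  have hprod1 : ∀ w : Fin 1 → ℝ, andersonTransferProd E (padSeq w) 1 = andersonTransfer E (w 0) := by
    intro w
    rw [andersonTransferProd_succ, andersonTransferProd_zero, mul_one, padSeq_of_lt w Nat.one_pos]
    rfl
  set g : ℝ → ℝ := (Metric.ball c ρ).indicator fun _ => η with hg
  have hgm : Measurable g := measurable_const.indicator Metric.isOpen_ball.measurableSet
  have hgle : ∀ a, g a ≤ Real.log ‖andersonTransfer E a‖ := by
    intro a
    by_cases ha : a ∈ Metric.ball c ρ
    · rw [hg, Set.indicator_of_mem ha]; exact hball a ha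
    · rw [hg, Set.indicator_of_notMem ha]; exact hMpos a
  have hgi : Integrable (fun w : Fin 1 → ℝ => g (w 0)) (Measure.pi fun _ : Fin 1 => μ) := by
    refine Integrable.of_bound ((hgm.comp (measurable_pi_apply 0)).aestronglyMeasurable) η ?_
    refine Eventually.of_forall fun w => ?_
    rw [Real.norm_eq_abs]
    by_cases ha : w 0 ∈ Metric.ball c ρ
    · rw [hg, Set.indicator_of_mem ha, abs_of_pos hη]
    · rw [hg, Set.indicator_of_notMem ha, abs_zero]; exact hη.le
  have hbox : ∀ᵐ z ∂(Measure.pi fun _ : Fin 1 => μ), ∀ k, k < 1 → |E - padSeq z k| ≤ D := by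
    have h := ae_pi_forall (μ := μ) (P := fun a => (E - a) ^ 2 + 2 ≤ D)
      (measurableSet_le (by fun_prop) measurable_const) hD 1
    filter_upwards [h] with z hz
    intro k hk
    rw [padSeq_of_lt z hk]
    have := hz ⟨k, hk⟩
    have := abs_le_sq_add_one (E - z ⟨k, hk⟩)
    linarith
  have hNm : Measurable fun x : Fin 1 → ℝ => Real.log ‖andersonTransferProd E (padSeq x) 1‖ :=
    (continuous_norm.comp (continuous_andersonTransferProd E 1)).measurable.log
  have hNI : Integrable (fun x : Fin 1 → ℝ => Real.log ‖andersonTransferProd E (padSeq x) 1‖)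
      (Measure.pi fun _ : Fin 1 => μ) := by
    refine Integrable.of_bound hNm.aestronglyMeasurable ((1 : ℕ) * Real.log (D + 1)) ?_
    filter_upwards [hbox] with z hz
    have h1 := norm_andersonTransferProd_le E hD0 (padSeq z) 1 hz
    have h0 := one_le_norm_of_det_eq_one _ (det_andersonTransferProd E (padSeq z) 1)
    rw [Real.norm_eq_abs, abs_of_nonneg (Real.log_nonneg h0), ← Real.log_pow]
    exact Real.log_le_log (by linarith) h1
  have hint_g : ∫ w : Fin 1 → ℝ, g (w 0) ∂(Measure.pi fun _ : Fin 1 => μ) = μ.real (Metric.ball c ρ) * η := by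
    have hmp := measurePreserving_eval (fun _ : Fin 1 => μ) 0
    have := integral_map (μ := Measure.pi fun _ : Fin 1 => μ) (measurable_pi_apply 0).aemeasurable
      (f := g) (hgm.aestronglyMeasurable)
    rw [hmp.map_eq] at this
    rw [← this, hg, integral_indicator_const _ Metric.isOpen_ball.measurableSet, smul_eq_mul]
  have hmono : ∫ w : Fin 1 → ℝ, g (w 0) ∂(Measure.pi fun _ : Fin 1 => μ) ≤
      ∫ w, Real.log ‖andersonTransferProd E (padSeq w) 1‖ ∂(Measure.pi fun _ : Fin 1 => μ) :=
    integral_mono hgi hNI fun w => by rw [hprod1]; exact hgle (w 0)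
  have hpos : 0 < μ.real (Metric.ball c ρ) * η :=
    mul_pos (measureReal_ball_pos_of_mem_support hc hρ) hη
  unfold andersonLogNormAvg
  rw [Nat.cast_one, div_one, one_mul]
  linarith

/-- Bounded support from compact support. [folklore] -/
theorem ae_abs_le_of_isCompact_support (μ : Measure ℝ) (h𝒜 : IsCompact μ.support) :
    ∃ R : ℝ, ∀ᵐ x ∂μ, |x| ≤ R := by
  obtain ⟨R, hR⟩ := h𝒜.isBounded.subset_closedBall 0
  refine ⟨R, ?_⟩
  filter_upwards [Measure.support_mem_ae (μ := μ)] with x hx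
  have := hR hx
  rwa [Metric.mem_closedBall, Real.dist_eq, sub_zero] at this

/-- **Fürstenberg positivity for the one-dimensional Anderson model** (Bucaj–Damanik–Fillman–
Gerbuz–VandenBoom–Wang–Zhang, Thm 2.3; Fürstenberg's theorem, Thm 2.1 there, for the laws
`ν_E = (M^E)_* μ̃`): if the single-site law has compact support containing at least two points, then
`L(E) = inf_{n ≥ 1} n⁻¹ 𝔼 log ‖M_n^E‖ > 0` for EVERY energy `E`.  Proof: Fürstenberg's entropy argument
in the slope chart (`AndersonModel1DPositivity.lean`), with the two-step non-invariance bound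
`exists_hellinger_two_step_lower` in place of absolute continuity of the site law.
[cite: BucajEtAl2019, Thm 2.3] -/
theorem BucajEtAl2019_lyapunovPos_holds : BucajEtAl2019_lyapunovPos := by
  intro μ hμ h𝒜 hnt E
  obtain ⟨R, hR⟩ := ae_abs_le_of_isCompact_support μ h𝒜
  obtain ⟨c, hc, hcn⟩ := andersonLogNormAvg_ge_of_nontrivial (μ := μ) hR hnt E
  have h1 := andersonLogNormAvg_one_pos (μ := μ) hR hnt E
  refine (lt_min hc h1).trans_le (le_ciInf fun n => ?_)
  rcases Nat.lt_or_ge (n + 1) 2 with h | h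
  · have hn : n = 0 := by omega
    subst hn
    exact min_le_right _ _
  · exact (min_le_left _ _).trans (hcn (n + 1) h)

end Assembly

section Continuity

open Topology
open scoped Matrix

/-- **Continuity of the Lyapunov exponent of the Anderson model** (Bucaj–Damanik–Fillman–Gerbuz–
VandenBoom–Wang–Zhang, Thm 2.6; Fürstenberg–Kifer): if the single-site law is a compactly supported
probability measure whose support has at least two points, `E ↦ L(E)` is continuous on `ℝ`.
Upper semicontinuity: `L = inf_n n⁻¹𝔼 log ‖M_n^E‖` is an infimum of continuous functions.  Lower
semicontinuity: by `exists_scale_uniform_vector_growth` there is ONE scale `n` at which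
`𝔼 log ‖M_n^{E₀} v‖ ≥ n(L(E₀) - ε/2)` for all unit `v`; this persists for `E` near `E₀` by joint
continuity and compactness of the circle, and `inf_v 𝔼 log ‖M_n^E v‖ ≤ n L(E)` (super-additivity).
[cite: BucajEtAl2019, Thm 2.6] -/
theorem BucajEtAl2019_lyapunovContinuous_holds : BucajEtAl2019_lyapunovContinuous := by
  intro μ _ hK hnt
  obtain ⟨R, hR0, -, hR⟩ := exists_ae_abs_le_of_isCompact_support μ hK
  obtain ⟨a₀, ha₀, b₀, hb₀, hab⟩ := hnt
  haveI : Nonempty (Metric.sphere (0 : EuclideanSpace ℝ (Fin 2)) 1) := ⟨⟨EuclideanSpace.single 0 1, by simp⟩⟩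
  refine continuous_iff_continuousAt.mpr fun E₀ => ?_
  rw [ContinuousAt, Metric.tendsto_nhds]
  intro ε hε
  -- upper semicontinuity
  have husc := andersonLyapunov_lt_add_nhds μ hR0 hR E₀ hε
  -- lower semicontinuity: one good scale at E₀ ...
  obtain ⟨n, hn, hgrow⟩ := exists_scale_uniform_vector_growth μ hR0 hR ha₀ hb₀ hab E₀ (half_pos hε)
  have hnpos : (0 : ℝ) < n := by exact_mod_cast hn
  -- ... the infimum over the circle is continuous in the energy ...
  have hunc : Continuous ↿(fun (E : ℝ) (w : (Metric.sphere (0 : EuclideanSpace ℝ (Fin 2)) 1)) =>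
      ∫ x, Real.log ‖Matrix.toEuclideanLin (andersonTransferProd E (padSeq x) n) (w : EuclideanSpace ℝ (Fin 2))‖
        ∂(Measure.pi fun _ : Fin n => μ)) :=
    continuous_integral_log_norm_transferProd_apply μ hR0 hR n
  have hbcont : Continuous fun E : ℝ => ⨅ w : (Metric.sphere (0 : EuclideanSpace ℝ (Fin 2)) 1),
      ∫ x, Real.log ‖Matrix.toEuclideanLin (andersonTransferProd E (padSeq x) n) (w : EuclideanSpace ℝ (Fin 2))‖
        ∂(Measure.pi fun _ : Fin n => μ) := by
    have h := IsCompact.continuous_sInf (isCompact_univ : IsCompact (Set.univ : Set (Metric.sphere (0 : EuclideanSpace ℝ (Fin 2)) 1))) hunc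
    simp only [Set.image_univ, sInf_range] at h
    exact h
  -- ... and exceeds n (L(E₀) - ε) at E₀, hence nearby
  have hb0 : (n : ℝ) * (andersonLyapunov μ E₀ - ε) < ⨅ w : (Metric.sphere (0 : EuclideanSpace ℝ (Fin 2)) 1),
      ∫ x, Real.log ‖Matrix.toEuclideanLin (andersonTransferProd E₀ (padSeq x) n) (w : EuclideanSpace ℝ (Fin 2))‖
        ∂(Measure.pi fun _ : Fin n => μ) := by
    refine lt_of_lt_of_le ?_ (le_ciInf hgrow)
    nlinarith
  have hev := hbcont.continuousAt.eventually (lt_mem_nhds hb0)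
  filter_upwards [husc, hev] with E hE1 hE2
  have h3 := iInf_integral_log_norm_apply_div_le_andersonLyapunov μ hR0 hR E hn
  rw [div_le_iff₀ hnpos] at h3
  rw [Real.dist_eq, abs_lt]
  constructor
  · nlinarith
  · linarith

end Continuity

end Literature.Probability.RandomMatrixProducts

end
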